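import Summits.CriticalPhenomena.SAWScalingLimit.Theorems.SAWDevelopingMapHexTransferYbRelayDefs
import Literature.Probability.RandomPlanarGeometry.EmbSAWLawSums
import Literature.Probability.RandomPlanarGeometry.EmbSAWRestrictionCovariance
import Literature.Probability.RandomPlanarGeometry.HexSAW
import HarnessLib

/-!
# Crux `LatticeUniversality` (stmt-CriticalPhenomena-0807), line `registered`: nesting of the face domain in `D`

Line lead prover-line-stmt-CriticalPhenomena-0807-c2-0 (2026-08-17). Groundwork for the research kernel
`stub_hexMicroRobustAll` of skeleton v3.3 (`Cruxes/LatticeUniversality/Lines/birth.lean`; analysis in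
`Cruxes/LatticeUniversality/K2-ANALYSIS-c2.md` §3): its only known reduction starts from EXACT RESTRICTION —
for nested discretisations with matched endpoints the critical hexagonal law of the sub-domain is the law of the
domain conditioned on confinement —, whose hypothesis is the NESTING of walks: every SAW of the small discrete
domain is, with the same support, a SAW of the big one. This file proves nesting for the pair (face domain of the
moving domain `S_δ(D) = σD − iδ/2`, `D`):

* `EmbDomainSAW.exists_support_eq_of_subset` — generic: for `Ω' ⊆ Ω` and a start vertex in the discrete
  domain `Ω_δ` (largest component), every SAW of `Ω'_δ` is, with the same support, a SAW of `Ω_δ` (each step is a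
  mesh edge of `Ω`, and `Ω_δ` is closed under mesh adjacency, `mem_embMeshDomain_of_adj`);
* `faceDomain_subset_symm_image` — the face domain of `Ω` at `e` lies in `S_δ⁻¹ Ω`;
* `carrier_map_map_eq_image_gmSimilarity` — the moving domain of the skeleton IS `S_δ(D)`;
* `faceDomain_shifted_subset_carrier` — hence the face domains of `S_δ(D)` lie in `D`;
* `exists_support_eq_faceDomain_shifted` / `faceNesting_shifted` — nesting: a hexagonal SAW of the face domain of
  `S_δ(D)` from a vertex of `D_δ` is, with the same support, a hexagonal SAW of `D_δ`;
* `hexSAWLaw_faceDomain_mul_confined_le`, `hexSAWLaw_confined_faceDomain_eq` — hence EXACT RESTRICTION for the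
  pair (instances of `Literature/…/EmbSAWRestrictionCovariance.lean` along the nesting): with matched endpoints
  `p ∈ D_δ`, `q`, the face-domain law times the confinement probability is at most the `D`-law, event by event,
  and the confinement probability is the ratio `Z_D⁻¹ · Z_face` of critical partition functions. So the kernel
  splits into endpoint relocation inside `D` and insensitivity to the confinement conditioning (false in total
  variation near the endpoints; open in the bounded-Lipschitz form — `K2-ANALYSIS-c2.md` §3).

Elementary; no new definitions; tagged [folklore].
-/

noncomputable section

namespace Summit.CriticalPhenomena.SAWScalingLimit.Cruxes.LatticeUniversality.Birth

open Set
open Complex (I I_ne_zero)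
open Literature.Probability.RandomPlanarGeometry
open Literature.Probability.RandomPlanarGeometry.SAW
open Literature.Probability.RandomPlanarGeometry.SAW.YangBaxter
open Literature.Probability.LatticeModels (HexVertex hexGraph hexCenter)
open Summit.CriticalPhenomena.SAWScalingLimit.Cruxes.HexTransfer.YbRelay (third faceDomain faceUnion faceComp
  gmSimilarity)

/-! ### Generic nesting of SAWs under inclusion of domains -/

section Generic

variable {V : Type*} {G : SimpleGraph V} {emb : V → ℂ} {Ω' Ω : Set ℂ} {δ : ℝ}

/-- A mesh edge of `Ω'` is a mesh edge of every `Ω ⊇ Ω'` (the segment lies in `Ω̄' ⊆ Ω̄`). [folklore] -/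
theorem embMeshGraph_adj_mono (hΩ : Ω' ⊆ Ω) {u v : V} (h : (embMeshGraph G emb Ω' δ).Adj u v) :
    (embMeshGraph G emb Ω δ).Adj u v := by
  rw [embMeshGraph_adj_iff] at h ⊢
  exact ⟨h.1, h.2.trans (closure_mono hΩ)⟩

/-- **A walk of `Ω'_δ` from a vertex of `Ω_δ` is a walk of `Ω_δ`** (`Ω' ⊆ Ω`): transport of a walk of the
graph `Ω'_δ` along the identity on vertices, each vertex being dragged into the largest component of `Ω` by
`mem_embMeshDomain_of_adj`. Returns a walk with the same support. [folklore] -/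
theorem exists_walk_support_eq_of_subset (hΩ : Ω' ⊆ Ω) :
    ∀ {u v : V} (p : (embDomainGraph G emb Ω' δ).Walk u v), u ∈ embMeshDomain G emb Ω δ →
      ∃ q : (embDomainGraph G emb Ω δ).Walk u v, q.support = p.support
  | _, _, SimpleGraph.Walk.nil, _ => ⟨SimpleGraph.Walk.nil, rfl⟩
  | u, v, SimpleGraph.Walk.cons (v := w) hadj p, hu => by
    obtain ⟨h1, -, hw'⟩ := (embDomainGraph_adj_iff G emb).1 hadj
    have h1Ω : (embMeshGraph G emb Ω δ).Adj u w := embMeshGraph_adj_mono hΩ h1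
    have hwV : w ∈ embMeshVertices emb Ω δ := hΩ (embMeshDomain_subset G emb Ω' δ hw')
    have hw : w ∈ embMeshDomain G emb Ω δ := mem_embMeshDomain_of_adj hu hwV h1Ω
    obtain ⟨q, hq⟩ := exists_walk_support_eq_of_subset hΩ p hw
    exact ⟨SimpleGraph.Walk.cons ((embDomainGraph_adj_iff G emb).2 ⟨h1Ω, hu, hw⟩) q,
      by rw [SimpleGraph.Walk.support_cons, SimpleGraph.Walk.support_cons, hq]⟩

/-- **Nesting of SAWs under inclusion of domains**: for `Ω' ⊆ Ω` and a start vertex `u` of the discrete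
domain `Ω_δ`, every SAW of `Ω'_δ` from `u` is, with the same support, a SAW of `Ω_δ` — the hypothesis of
exact restriction covariance. [folklore] -/
theorem EmbDomainSAW.exists_support_eq_of_subset (hΩ : Ω' ⊆ Ω) {u v : V} (hu : u ∈ embMeshDomain G emb Ω δ)
    (γ' : EmbDomainSAW G emb Ω' δ u v) :
    ∃ γ : EmbDomainSAW G emb Ω δ u v, γ.walk.support = γ'.walk.support := by
  obtain ⟨q, hq⟩ := exists_walk_support_eq_of_subset hΩ γ'.walk hu
  refine ⟨⟨q, ?_⟩, hq⟩
  rw [SimpleGraph.Walk.isPath_def, hq]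
  exact γ'.isPath.support_nodup

end Generic

/-! ### The face domains of the moving domain `S_δ(D)` lie in `D` -/

/-- The face domain of `Ω` at `e` lies in `S_δ⁻¹ Ω`: every rhombus of the face component is a face of `Ω_δ`,
whose rescaled closed rhombus lies in `Ω`. [folklore] -/
theorem faceDomain_subset_symm_image (Ω : Set ℂ) (δ : ℝ) (e : MidEdge) :
    faceDomain Ω δ e ⊆ (gmSimilarity δ).symm '' Ω := by
  rintro _ ⟨w, hw, rfl⟩
  refine ⟨w, ?_, rfl⟩
  have hw' : w ∈ faceUnion (meshFaces third Ω δ) e δ := interior_subset hw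
  simp only [faceUnion, mem_iUnion, mem_image] at hw'
  obtain ⟨g, hg, z, hz, rfl⟩ := hw'
  exact hg.1 z hz

/-- The moving domain of the skeleton, `((D.map σ).map (z ↦ z − iδ/2)).carrier`, is `S_δ(D)` with
`S_δ z = i z − iδ/2` (`gmSimilarity δ`). [folklore] -/
theorem carrier_map_map_eq_image_gmSimilarity (D : DobrushinDomain) (δ : ℝ) :
    ((D.map (similarity I I_ne_zero 0)).map (similarity 1 one_ne_zero (-(I * (δ : ℂ) / 2)))).carrier =
      gmSimilarity δ '' D.carrier := by
  rw [MarkedDomain.carrier_map, MarkedDomain.carrier_map, image_image]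
  refine image_congr fun z _ => ?_
  rw [Cruxes.HexTransfer.YbRelay.gmSimilarity_apply, similarity_apply, similarity_apply]
  ring

/-- **The face domains of the moving domain `S_δ(D)` lie in `D`.** [folklore] -/
theorem faceDomain_shifted_subset_carrier (D : DobrushinDomain) (δ : ℝ) (e : MidEdge) :
    faceDomain (((D.map (similarity I I_ne_zero 0)).map
      (similarity 1 one_ne_zero (-(I * (δ : ℂ) / 2)))).carrier) δ e ⊆ D.carrier := by
  rw [carrier_map_map_eq_image_gmSimilarity]
  refine (faceDomain_subset_symm_image _ δ e).trans ?_
  rw [← image_comp]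
  rintro _ ⟨z, hz, rfl⟩
  simpa using hz

/-- **Nesting for the micro-robustness kernel**: a hexagonal SAW of the face domain of `S_δ(D)` (at any
mid-edge `e`) started at a vertex `p` of the discrete domain `D_δ` is, with the same support, a hexagonal SAW
of `D_δ` between the same endpoints — the hypothesis under which the face-domain law is the `D`-law conditioned
on confinement (exact restriction). [folklore] -/
theorem exists_support_eq_faceDomain_shifted (D : DobrushinDomain) (δ : ℝ) (e : MidEdge) {p q : HexVertex}
    (hp : p ∈ embMeshDomain hexGraph hexCenter D.carrier δ)
    (γ' : HexDomainSAW (faceDomain (((D.map (similarity I I_ne_zero 0)).map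
      (similarity 1 one_ne_zero (-(I * (δ : ℂ) / 2)))).carrier) δ e) δ p q) :
    ∃ γ : HexDomainSAW D.carrier δ p q, γ.walk.support = γ'.walk.support :=
  EmbDomainSAW.exists_support_eq_of_subset (faceDomain_shifted_subset_carrier D δ e) hp γ'

/-- **Nesting for the micro-robustness kernel, closed form** (registered sub-goal of crux stmt-CriticalPhenomena-0807,
line `registered`): for every Dobrushin domain `D`, mesh `δ`, mid-edge `e` and start vertex `p ∈ D_δ`, every
hexagonal SAW of the face domain of `S_δ(D)` at `e` from `p` is, with the same support, a hexagonal SAW of `D_δ`.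
[folklore] -/
theorem faceNesting_shifted : ∀ (D : DobrushinDomain) (δ : ℝ) (e : MidEdge) (p q : HexVertex), p ∈ embMeshDomain hexGraph hexCenter D.carrier δ → ∀ γ' : HexDomainSAW (faceDomain (((D.map (similarity I I_ne_zero 0)).map (similarity 1 one_ne_zero (-(I * (δ : ℂ) / 2)))).carrier) δ e) δ p q, ∃ γ : HexDomainSAW D.carrier δ p q, γ.walk.support = γ'.walk.support :=
  fun D δ e _ _ hp γ' => exists_support_eq_faceDomain_shifted D δ e hp γ'

/-! ### Exact restriction for the face domains of `S_δ(D)` inside `D` -/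

/-- **Exact restriction, inequality form, for the face domain of `S_δ(D)` inside `D`**: for a start vertex
`p ∈ D_δ`, every set `E` of curve classes and every mid-edge `e`,
`P^{face}_{p,q}(curve ∈ E) · P^{D}_{p,q}(γ is confined to the face domain) ≤ P^{D}_{p,q}(curve ∈ E)`.
[cite: LawlerSchrammWerner2004SAW, §3] -/
theorem hexSAWLaw_faceDomain_mul_confined_le (D : DobrushinDomain) (δ : ℝ) (e : MidEdge) {p q : HexVertex}
    (hp : p ∈ embMeshDomain hexGraph hexCenter D.carrier δ) (E : Set (CurveClass ℂ)) :
    hexSAWLaw (faceDomain (((D.map (similarity I I_ne_zero 0)).map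
        (similarity 1 one_ne_zero (-(I * (δ : ℂ) / 2)))).carrier) δ e) δ p q {γ' | γ'.curve ∈ E} *
      hexSAWLaw D.carrier δ p q
        {γ | ∃ γ' : HexDomainSAW (faceDomain (((D.map (similarity I I_ne_zero 0)).map
          (similarity 1 one_ne_zero (-(I * (δ : ℂ) / 2)))).carrier) δ e) δ p q,
          γ'.walk.support = γ.walk.support} ≤
      hexSAWLaw D.carrier δ p q {γ | γ.curve ∈ E} :=
  hexSAWLaw_mul_hexSAWLaw_setOf_exists_support_eq_le (exists_support_eq_faceDomain_shifted D δ e hp) E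

/-- **Confinement probability = ratio of critical partition functions** for the face domain of `S_δ(D)` inside
`D`: `P^{D}_{p,q}(γ is confined to the face domain) = Z_D⁻¹ · Z_face` (junk cases included).
[cite: LawlerSchrammWerner2004SAW, §3] -/
theorem hexSAWLaw_confined_faceDomain_eq (D : DobrushinDomain) (δ : ℝ) (e : MidEdge) {p q : HexVertex}
    (hp : p ∈ embMeshDomain hexGraph hexCenter D.carrier δ) :
    hexSAWLaw D.carrier δ p q
        {γ | ∃ γ' : HexDomainSAW (faceDomain (((D.map (similarity I I_ne_zero 0)).map
          (similarity 1 one_ne_zero (-(I * (δ : ℂ) / 2)))).carrier) δ e) δ p q,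
          γ'.walk.support = γ.walk.support} =
      (hexSAWWeight D.carrier δ p q univ)⁻¹ *
        hexSAWWeight (faceDomain (((D.map (similarity I I_ne_zero 0)).map
          (similarity 1 one_ne_zero (-(I * (δ : ℂ) / 2)))).carrier) δ e) δ p q univ :=
  hexSAWLaw_setOf_exists_support_eq_eq (exists_support_eq_faceDomain_shifted D δ e hp)

end Summit.CriticalPhenomena.SAWScalingLimit.Cruxes.LatticeUniversality.Birth

end
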